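import Summits.FinalStateConjecture.FinalStateConjecture.Theorems.ExactKerrEndsSettlingAlongCensoredKerrEndsGaugedFamily
import HarnessLib

/-!
# Crux `SettlingAlongCensoredKerrEnds` (stmt-FinalStateConjecture-18520), line `wall-cone-sections`:
# stub GU `stub_gaugeBorneUpgrade` — SETTLED TAME CURVES NEED NEITHER INJECTIVITY NOR IMMERSION
# (file 3 of 3: the registered stub, verbatim)

The stub (registered 2026-08-17 by the crux-strategist, `Cruxes/SettlingAlongCensoredKerrEnds/Lines/
wall_cone_sections.lean`): for every `X`, end `e` and TAME curve `H` of admissible data on `e` whose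
members off `0` are SETTLED (the Statement's settling clause for every maximal vacuum Cauchy
development, verbatim) — no injectivity, no immersion assumed — there are an end `e'` and a tame,
INJECTIVE, IMMERSED curve `F'` of admissible data with `F' 0 = H 0` whose members off `0` are settled.
In the line it receives the cone ray over the Lipschitz walls (an even reparametrisation, flat at the
corner) and returns the witness curve the crux asks for; together with the composition
`SettlingAlongCensoredKerrEnds_of` of the line this leaves the physics stub PW
(`stub_lipschitzWallsInKickUnfolding`) as the line's only open obligation.

Proof: the gauged family of `H` on a breathing ball far out on `e` (file 2,
`…GaugedFamily.lean`: tame on the collared end `e.restrict _`, immersed at `0`, admissible, settled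
off `0`, through `H 0`), made injective on a window by
`Literature.Geometry.Lorentzian.InitialDataSet.exists_tameCurve_of_localWindow`. No definitions, no
named facts.

References: Christodoulou, CQG 16 (1999) A23, p. A24 (genericity by lines in a fixed space of data);
Lee, *Introduction to Smooth Manifolds* (2013), Prop. 2.25; Bartnik–Isenberg 2004, §2 (diffeomorphism
covariance of the constraints); Choquet-Bruhat–Geroch, CMP 14 (1969), p. 330 (covariance of
developments); Dafermos–Rodnianski, arXiv:0811.0354, App. B.2.3 (the weights); Dieudonné 1960, (8.12.6).
-/

-- the doubled `FinalStateConjecture.FinalStateConjecture` path component trips dupNamespace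
set_option linter.dupNamespace false

noncomputable section

open Set Function Filter Metric TopologicalSpace Bundle
open scoped Manifold ContDiff Topology ENNReal

namespace Summit.FinalStateConjecture.FinalStateConjecture.Theorems.ExactKerrEnds

open Literature.Geometry.Lorentzian
open Summit.FinalStateConjecture (HasCompleteNullInfinity exteriorOf RaysStayInClosure HasExhaustiveCharts
  IsFutureOriented)

open GaugeBorneUpgrade


/-- **Stub GU `stub_gaugeBorneUpgrade` of line `wall-cone-sections` (crux `SettlingAlongCensoredKerrEnds`,
stmt-FinalStateConjecture-18520) — SETTLED TAME CURVES NEED NEITHER INJECTIVITY NOR IMMERSION.** For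
every `X`, end `e` and tame curve `H` of admissible data on `e` whose members off `0` are settled,
there are an end `e'` and a tame, injective, immersed curve `F'` of admissible data with `F' 0 = H 0`
whose members off `0` are settled. Proof: the gauged family of `H` on a breathing ball far out on `e`
(§3: tame on the collared end `e.restrict _`, immersed at `0`, admissible, settled off `0`, through
`H 0`), made injective on a window by `InitialDataSet.exists_tameCurve_of_localWindow`. VERBATIM the
registered signature. [cite: Christodoulou1999, p. A24] -/
theorem stub_gaugeBorneUpgrade :
    ∀ (X : Type) [TopologicalSpace X] [ChartedSpace E3 X] [IsManifold (𝓡 3) ∞ X] [T2Space X]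
      [SecondCountableTopology X] [ConnectedSpace X],
      ∀ (e : AFEnd X) (H : EuclideanSpace ℝ (Fin 1) → InitialDataSet (𝓡 3) X),
        InitialDataSet.IsTameDataFamily e 1 H →
          (∀ c, H c ∈ admissibleVacuumData X) →
            (∀ c ≠ 0, ∀ 𝒟 : VacuumCauchyDevelopment (H c), 𝒟.IsMaximal →
              Summit.FinalStateConjecture.HasCompleteNullInfinity 𝒟.toCauchyDevelopment ∧
                ∃ (O : Set 𝒟.carrier) (d : FinalStateDecomposition 𝒟.toSpacetime O 2),
                  (∀ i, Kerr.IsSubextremal (d.mass i) (d.spin i)) ∧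
                    O = Summit.FinalStateConjecture.exteriorOf 𝒟.toCauchyDevelopment d.charted ∧
                      Summit.FinalStateConjecture.RaysStayInClosure 𝒟.toCauchyDevelopment O ∧
                        Summit.FinalStateConjecture.HasExhaustiveCharts d ∧
                          Summit.FinalStateConjecture.IsFutureOriented d) →
              ∃ (e' : AFEnd X) (F' : EuclideanSpace ℝ (Fin 1) → InitialDataSet (𝓡 3) X),
                InitialDataSet.IsTameDataFamily e' 1 F' ∧ F' 0 = H 0 ∧ Injective F' ∧
                  InitialDataSet.IsImmersedAtZero 1 F' ∧ (∀ c, F' c ∈ admissibleVacuumData X) ∧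
                    ∀ c ≠ 0, ∀ 𝒟 : VacuumCauchyDevelopment (F' c), 𝒟.IsMaximal →
                      Summit.FinalStateConjecture.HasCompleteNullInfinity 𝒟.toCauchyDevelopment ∧
                        ∃ (O : Set 𝒟.carrier) (d : FinalStateDecomposition 𝒟.toSpacetime O 2),
                          (∀ i, Kerr.IsSubextremal (d.mass i) (d.spin i)) ∧
                            O = Summit.FinalStateConjecture.exteriorOf 𝒟.toCauchyDevelopment
                                  d.charted ∧
                              Summit.FinalStateConjecture.RaysStayInClosure 𝒟.toCauchyDevelopment O ∧
                                Summit.FinalStateConjecture.HasExhaustiveCharts d ∧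
                                  Summit.FinalStateConjecture.IsFutureOriented d := by
  intro X _ _ _ _ _ _ e H hH hadm hgood
  -- a breathing ball far out on the end (as in `InitialDataSet.exists_tame_selfWitness`)
  set z₀ : E3 := (e.R + 3) • EuclideanSpace.single (0 : Fin 3) (1 : ℝ) with hz₀
  have hz₀n : ‖z₀‖ = e.R + 3 := by
    rw [hz₀, norm_smul, PiLp.norm_single, norm_one, mul_one,
      Real.norm_of_nonneg (by linarith [e.R_pos])]
  have B : e.BreathingData z₀ 1 := ⟨one_pos, by rw [hz₀n]; linarith⟩
  have hR₁ : e.R < e.R + 1 := by linarith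
  -- the gauged family: tame on the collar, immersed at `0`, admissible, settled off `0`
  have h2 := isTameDataFamily_restrict_gauged B H hH hR₁
  have h3 := isImmersedAtZero_gauged B H hH.1
  obtain ⟨F', hF', hF'0, hinj, himm, hadm', hgood'⟩ :=
    InitialDataSet.exists_tameCurve_of_localWindow (𝓓 := admissibleVacuumData X)
      (P := fun D : InitialDataSet (𝓡 3) X ↦ ∀ 𝒟 : VacuumCauchyDevelopment D, 𝒟.IsMaximal →
        Summit.FinalStateConjecture.HasCompleteNullInfinity 𝒟.toCauchyDevelopment ∧
          ∃ (O : Set 𝒟.carrier) (d : FinalStateDecomposition 𝒟.toSpacetime O 2),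
            (∀ i, Kerr.IsSubextremal (d.mass i) (d.spin i)) ∧
              O = Summit.FinalStateConjecture.exteriorOf 𝒟.toCauchyDevelopment d.charted ∧
                Summit.FinalStateConjecture.RaysStayInClosure 𝒟.toCauchyDevelopment O ∧
                  Summit.FinalStateConjecture.HasExhaustiveCharts d ∧
                    Summit.FinalStateConjecture.IsFutureOriented d)
      h2 h3 zero_lt_one (fun c _ ↦ gauged_mem_admissibleVacuumData B H hadm c)
      (fun c hc _ ↦ settled_gauged B H hgood c hc)
  refine ⟨e.restrict hR₁.le, F', hF', hF'0.trans ?_, hinj, himm, hadm', fun c hc ↦ hgood' c hc⟩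
  exact gauged_zero B H

end Summit.FinalStateConjecture.FinalStateConjecture.Theorems.ExactKerrEnds

end
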